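import Summits.QuantumFields.QCD.Theses.SpectralDefectExtinction
import Summits.QuantumFields.QCD.Theorems.SpectralDefectExtinctionPositivityDeficitLeDefects
import Summits.QuantumFields.QCD.Theorems.SpectralDefectExtinctionExtinctionBuildsQCDStubIndexAPSubPerLeWindow
import Literature.Barriers.QuantumFields.WilsonDeterminantSign
import Literature.MathematicalPhysics.QuantumFieldTheory.QCDPhaseQuenched
import Literature.MathematicalPhysics.QuantumLattice.WilsonDiracAP

/-!
# Stub `stub_apSignDefectForcesPerDefect` of line `block-away-the-sign`
(crux `Summit.QuantumFields.QCD.Theses.SpectralDefectExtinction.ExtinctionBuildsQCD`, item stmt-QuantumFields-18064)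

**An antiperiodic sign defect forces a periodic EXTINCT defect, configuration-wise.** With `C₀ = 8π`: if the
(real) all-antiperiodic Wilson determinant `det D_W^{AP}(U, m_crit + w)` (tree
`Literature.MathematicalPhysics.QuantumLattice.wilsonDiracAP U μ = wilsonDirac ρ_{U(3)} (apLift U) μ 1`) is negative
and `C₀/L < c·w`, then the PERIODIC operator has a sign defect (a real eigenvalue of `D_W(U,0,1)` below
`−(m_crit + w)`) or a window defect (an eigenvalue of `Γ₅ D_W(U, m_crit + w, 1)` with `|λ| < c·w`).

Proof (index parity).  Write `μ₀ = m_crit + w`, `H^{per} = Γ₅ D_W(U, μ₀, 1)`, `H^{AP} = Γ₅ D_W^{AP}(U, μ₀)`; both are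
Hermitian and `Re det D_W = (−1)^{n₋} ∏_i |λ_i|`
(`Literature.Barriers.QuantumFields.WilsonDeterminant.re_fermionDet_wilsonDirac`, `n₋` = number of negative
eigenvalues of `Γ₅ D_W`).
* If `Re det D_W^{per}(μ₀) < 0`: the proved support
  `PositivityDeficitLeDefects.one_le_countP_of_re_fermionDet_neg` gives a real eigenvalue of `D_W(U,0,1)` below `−μ₀`.
* If `Re det D_W^{per}(μ₀) = 0`: some `λ_i(H^{per}) = 0`, a window eigenvalue (`|0| < c·w`).
* If `Re det D_W^{per}(μ₀) > 0 > Re det D_W^{AP}(μ₀)`: `n₋(H^{per})` is even and `n₋(H^{AP})` is odd, so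
  `|n₋(H^{AP}) − n₋(H^{per})| ≥ 1`; the landed Weyl comparison across the boundary condition
  (`IndexAPSubPer.abs_negCount_AP_sub_per_le`, stub `stub_indexAPSubPerLeWindow`) bounds this by the number of
  eigenvalues of `H^{per}` with `|λ| ≤ 8π/L < c·w`.

References: MontvayMunster1994 §4.2.4 (4.112)–(4.115), §5.1.2 (5.15)–(5.16); EdwardsHellerNarayanan1998 §3;
Bhatia, Matrix Analysis, Cor. III.2.6.
-/

noncomputable section

namespace Summit.QuantumFields.QCD.Cruxes.ExtinctionBuildsQCD.BlockAwayTheSign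

open scoped BigOperators Topology Classical MeasureTheory Matrix
open Filter MeasureTheory Matrix
open Literature.MathematicalPhysics.QuantumLattice Literature.MathematicalPhysics.AQFT
  Literature.MathematicalPhysics.QuantumFieldTheory
open Summit.QuantumFields.QCD.Theses.SpectralDefectExtinction
open Summit.QuantumFields.QCD.Theses
open Literature.Barriers.QuantumFields.WilsonDeterminant

namespace APSignDefect

/-! ## §1 Root counts of a Hermitian matrix and the parity of `n₋` -/

section Counting

variable {n : Type*} [Fintype n] [DecidableEq n]

-- adapted from Summits/QuantumFields/QCD/Theorems/SpectralDefectExtinctionExtinctionBuildsQCDStubIndexAPSubPerLeWindowAux.lean:countP_roots_eq_card_filter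
/-- For a Hermitian matrix the root count of the characteristic polynomial with a real predicate is the
eigenvalue count.  (`private`: landed copies exist only in modules this line must not import, cf. the note in
`…StubIndexAPSubPerLeWindowAux.lean`.) -/
private theorem countP_roots_eq_card_filter {A : Matrix n n ℂ} (hA : A.IsHermitian) (p : ℝ → Prop)
    [DecidablePred p] :
    A.charpoly.roots.countP (fun z => p z.re) =
      (Finset.univ.filter fun i => p (hA.eigenvalues i)).card := by
  rw [hA.roots_charpoly_eq_eigenvalues, Multiset.countP_map, Finset.card_def, Finset.filter_val]
  congr 1

omit [Fintype n] [DecidableEq n] in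
/-- Monotonicity of `Multiset.countP` in the predicate.  (`private`: a landed copy `countP_mono_pred` exists only in
a module this line must not import.) -/
private theorem countP_le_countP_of_imp {α : Type*} (s : Multiset α) {p q : α → Prop} [DecidablePred p]
    [DecidablePred q] (h : ∀ a, p a → q a) : s.countP p ≤ s.countP q := by
  rw [Multiset.countP_eq_card_filter, Multiset.countP_eq_card_filter]
  exact Multiset.card_le_card (Multiset.monotone_filter_right s h)

end Counting

section Parity

variable {L N : ℕ} [NeZero L] {G : Type*} [Group G] (ρ : G →* Matrix (Fin N) (Fin N) ℂ)
  (hρ : ∀ g, ρ g ∈ Matrix.unitaryGroup (Fin N) ℂ)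

/-- The number `n₋` of negative eigenvalues of `Γ₅ D_W(V, m, r)` is the number of roots of its characteristic
polynomial with negative real part (with multiplicity). -/
theorem negModes_eq_countP (V : GaugeConfig 4 L G) (m r : ℝ) :
    negModes ρ hρ V m r =
      Multiset.countP (fun z : ℂ => z.re < 0) (spinorLift gammaFive * wilsonDirac ρ V m r).charpoly.roots :=
  (countP_roots_eq_card_filter (isHermitian_hermitianWilsonDirac ρ hρ V m r) (· < 0)).symm

/-- **Negative determinant ⇒ odd `n₋`** (`Re det D_W = (−1)^{n₋} ∏ |λ_i|` with `∏ |λ_i| ≥ 0`). -/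
theorem odd_negModes_of_re_neg (V : GaugeConfig 4 L G) (m r : ℝ)
    (h : (fermionDet (wilsonDirac ρ V m r)).re < 0) : Odd (negModes ρ hρ V m r) := by
  rw [re_fermionDet_wilsonDirac ρ hρ V m r] at h
  rcases Nat.even_or_odd (negModes ρ hρ V m r) with he | ho
  · rw [he.neg_one_pow, one_mul] at h
    exact absurd h (not_lt.mpr (Finset.prod_nonneg fun i _ => abs_nonneg _))
  · exact ho

/-- **Positive determinant ⇒ even `n₋`** (`Re det D_W = (−1)^{n₋} ∏ |λ_i|` with `∏ |λ_i| ≥ 0`). -/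
theorem even_negModes_of_re_pos (V : GaugeConfig 4 L G) (m r : ℝ)
    (h : 0 < (fermionDet (wilsonDirac ρ V m r)).re) : Even (negModes ρ hρ V m r) := by
  rw [re_fermionDet_wilsonDirac ρ hρ V m r] at h
  rcases Nat.even_or_odd (negModes ρ hρ V m r) with he | ho
  · exact he
  · rw [ho.neg_one_pow, neg_one_mul, neg_pos] at h
    exact absurd h (not_lt.mpr (Finset.prod_nonneg fun i _ => abs_nonneg _))

include hρ in
/-- **Vanishing determinant ⇒ a zero mode**, hence a window eigenvalue of `Γ₅ D_W(V, m, r)` for every window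
`ε > 0`. -/
theorem one_le_countP_of_re_eq_zero (V : GaugeConfig 4 L G) (m r : ℝ)
    (h : (fermionDet (wilsonDirac ρ V m r)).re = 0) {ε : ℝ} (hε : 0 < ε) :
    1 ≤ Multiset.countP (fun z : ℂ => |z.re| < ε) (spinorLift gammaFive * wilsonDirac ρ V m r).charpoly.roots := by
  have hA := isHermitian_hermitianWilsonDirac ρ hρ V m r
  rw [re_fermionDet_wilsonDirac ρ hρ V m r, mul_eq_zero] at h
  have hprod : ∏ i, |hA.eigenvalues i| = 0 :=
    h.resolve_left (pow_ne_zero _ (neg_ne_zero.mpr one_ne_zero))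
  obtain ⟨i, -, hi⟩ := Finset.prod_eq_zero_iff.mp hprod
  have key : Multiset.countP (fun z : ℂ => |z.re| < ε)
      (spinorLift gammaFive * wilsonDirac ρ V m r).charpoly.roots =
        (Finset.univ.filter fun i => |hA.eigenvalues i| < ε).card :=
    countP_roots_eq_card_filter hA (fun x => |x| < ε)
  rw [key]
  exact Nat.succ_le_of_lt
    (Finset.card_pos.mpr ⟨i, Finset.mem_filter.mpr ⟨Finset.mem_univ _, by rw [hi]; exact hε⟩⟩)

end Parity

end APSignDefect

/-! ## §2 The registered stub -/

/-- **Stub F — an antiperiodic sign defect forces a periodic EXTINCT defect (provable now).** There is an absolute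
constant `C₀ > 0` such that: if the (real, tree `fermionDet_wilsonDiracAP_eq_re`) all-antiperiodic Wilson determinant at
bare mass `m_crit + w` is negative and the torus is long enough that the boundary-condition window `C₀/L` sits inside the
coercivity window `c·w`, then the PERIODIC operator has a sign defect (a real eigenvalue of `D_W(U,0,1)` below
`−(m_crit+w)`) or a window defect (an eigenvalue of `Γ₅D_W(U, m_crit+w, 1)` within `c·w` of zero), configuration-wise.
Route: if `Re det D_W^{per} < 0`, tree `PositivityDeficitLeDefects.one_le_countP_of_re_fermionDet_neg`; if
`det D_W^{per} = 0`, zero is a window eigenvalue; if `det D_W^{per} > 0 > det D_W^{AP}`, along the uniformly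
`e^{−iθ}`-twisted `U(3)` fields `θ ∈ [0, π/L]` interpolating `unitaryLift U` to the gauge transform of `apLift U` (Stub W's
mechanism; `det` gauge invariant: `fermionDet_wilsonDirac_gaugeTransform`) the real determinant
(`fermionDet_wilsonDirac_im_holds` for unitary links) changes sign, so by the intermediate value theorem some twisted
Hermitian operator `Γ₅D_W(e^{−iθ}·unitaryLift U, m_crit+w)` is singular, and min–max (form bound `24θ ≤ 24π/L`) gives the
periodic one an eigenvalue in `[−C₀/L, C₀/L] ⊂ (−cw, cw)`. [MontvayMunster1994 §4.2.4; folklore (IVT + Weyl)] -/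
theorem stub_apSignDefectForcesPerDefect :
    ∃ C₀ : ℝ, 0 < C₀ ∧ ∀ (L : ℕ) [NeZero L] (U : GaugeConfig 4 L SU3) (mcrit w c : ℝ), 0 < w → 0 < c →
      C₀ / L < c * w →
      (fermionDet (Literature.MathematicalPhysics.QuantumLattice.wilsonDiracAP U (mcrit + w))).re < 0 →
      1 ≤ Multiset.countP (fun z : ℂ => z.im = 0 ∧ z.re < -(mcrit + w))
            (wilsonDirac (fundamentalRep (Fin 3)) U 0 1).charpoly.roots +
          Multiset.countP (fun z : ℂ => |z.re| < c * w)
            (spinorLift gammaFive * wilsonDirac (fundamentalRep (Fin 3)) U (mcrit + w) 1).charpoly.roots := by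
  refine ⟨8 * Real.pi, by positivity, fun L _ U mcrit w c hw hc hL hAP => ?_⟩
  rcases lt_or_ge (fermionDet (wilsonDirac (fundamentalRep (Fin 3)) U (mcrit + w) 1)).re 0 with hneg | hnn
  · -- Case A: a periodic sign defect
    exact le_add_right
      (Summit.QuantumFields.QCD.Theorems.PositivityDeficitLeDefects.one_le_countP_of_re_fermionDet_neg U _ hneg)
  · -- Case B: a periodic window defect
    refine le_add_left ?_
    rcases hnn.eq_or_lt with h0 | hpos
    · -- `det D_W^{per} = 0`: zero is a window eigenvalue
      exact APSignDefect.one_le_countP_of_re_eq_zero (fundamentalRep (Fin 3)) fundamentalRep_mem_unitaryGroup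
        U (mcrit + w) 1 h0.symm (mul_pos hc hw)
    · -- `det D_W^{per} > 0 > det D_W^{AP}`: index parity + the Weyl comparison across the boundary condition
      have hW := IndexAPSubPer.abs_negCount_AP_sub_per_le U (mcrit + w)
      have hodd : Odd (Multiset.countP (fun z : ℂ => z.re < 0)
          (spinorLift gammaFive *
            Literature.MathematicalPhysics.QuantumLattice.wilsonDiracAP U (mcrit + w)).charpoly.roots) := by
        have h := APSignDefect.odd_negModes_of_re_neg (unitaryFundamentalRep (Fin 3) ℂ)
          unitaryFundamentalRep_mem_unitaryGroup (apLift U) (mcrit + w) 1 hAP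
        rwa [APSignDefect.negModes_eq_countP] at h
      have heven : Even (Multiset.countP (fun z : ℂ => z.re < 0)
          (spinorLift gammaFive * wilsonDirac (fundamentalRep (Fin 3)) U (mcrit + w) 1).charpoly.roots) := by
        have h := APSignDefect.even_negModes_of_re_pos (fundamentalRep (Fin 3)) fundamentalRep_mem_unitaryGroup
          U (mcrit + w) 1 hpos
        rwa [APSignDefect.negModes_eq_countP] at h
      have hwin : 1 ≤ Multiset.countP (fun z : ℂ => |z.re| ≤ 8 * Real.pi / L)
          (spinorLift gammaFive * wilsonDirac (fundamentalRep (Fin 3)) U (mcrit + w) 1).charpoly.roots := by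
        obtain ⟨k, hk⟩ := hodd
        obtain ⟨j, hj⟩ := heven
        have h2 := abs_le.mp hW
        omega
      exact hwin.trans (APSignDefect.countP_le_countP_of_imp _ fun z hz => lt_of_le_of_lt hz hL)

end Summit.QuantumFields.QCD.Cruxes.ExtinctionBuildsQCD.BlockAwayTheSign

end
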